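import Summits.KontsevichZagierPeriods.KontsevichZagierPeriods.Theorems.RootDecompWalshStrataSectorSpecimen
import Summits.KontsevichZagierPeriods.KontsevichZagierPeriods.Theorems.RootDecompWalshStrataEulerDescent12
import Summits.KontsevichZagierPeriods.KontsevichZagierPeriods.Theorems.RootDecompWalshStrataScaledLW02

/-!
# Root decomposition & Walsh strata — E-type sectors with LINE WALLS, part 1 (gen 8, §34.1–34.3; v3)

The specimen of §33 turned into an INSTRUMENT.  For the elliptic-polar chart with weights `κ₀ > 0`,
`κ₁ ≥ 0` and the weight `γ√(a(κ₀X² + κ₁Y²) + c)` (`a ≠ 0`) on an open piece `T` of the normalised sector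
`{0 < Y < X, κ₀X² + κ₁Y² < 1}`, suppose a closed set `C ⊇ T` inside the closed sector is given such that
every point of `C ∖ T` off the axis `X = 0` lies on the conic `a(κ₀X² + κ₁Y²) + c = 0` or on one of
finitely many RATIONAL LINES `k₀ + k₁X + k₂Y = 0`, each line through the centre (`k₀ = 0`) being a genuine
line.  Along a line with `k₀ ≠ 0` the chart reads `r·L(t) = −k₀N(t)`, `L = k₁ + k₂t`, `N = √W`,
`W = κ₀ + κ₁t²`, and the boundary term of the engine is `(γ/(3a))·M√M/(|L|L²W)` with the quadratic
`M(t) = a k₀²W + cL² = et² + ft + g`.  EVERY stratum of `M` is a terminal: (i) `e ≠ 0`, `4eg ≠ f²` —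
the landed Euler terminal `InBaker.sqrt_rational`; (ii) `e = 0 ≠ f` — the landed linear-radicand terminal
`InBaker.linear_factor` (polynomial chart `ft + g = u²`, rational pull-back); (iii) `4eg = f²`, `e ≠ 0`
(`InBaker.sqrt_tangent`: `√M = √e·|t − t₁|`) and (iv) `e = f = 0` (constant radicand `g`) through the
SCALED RATIONAL CLASS of the denominator `|L|L²W`, `InBaker.sqrt_const_LW` (§35: partial fractions over
`ℚ` + the atoms polynomial / simple, double, TRIPLE pole / even and ODD part over `W`) — together the
rational-factor analogue of the landed all-strata polynomial terminal `InBaker.poly_sqrt`.  Hence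
`[T, γ√(a(κ₀X² + κ₁Y²) + c)] ∈ InBaker` with NO condition on the lines off the centre
(`InBaker.of_psector_walls`).  The boundary sections of the chart domain are dispatched as in the
specimen: `frontier_pchartDom_subset` localises them (`psector_frontier_facts`); the centre segment
`r = 0` carries `(γc√c/(3a))/W` — the landed `InBaker.sqrt_const_even` if `c > 0`, zero otherwise; the
conic wall carries `0`; a line through the centre is the vertical wall `t = −k₁/k₂` (null); a line
`k₀ ≠ 0` is `InBaker.psection_line` on a `t`-set at distance `≥ min(1, k₀²κ₀)/|k₂|` from the pole
(`exists_hull_of_margin`).  As a check the specimen's sector lemma is re-derived in a few lines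
(`inBaker_specA'`).  NOT covered here (the one E-type residual of the node after §34–35): the adapted
CONIC walls `p∘ℓ = 0` of a wall-family atom (R-E2: the height move `InBaker.psection_height`).
[KontsevichZagier2001 §1.2 rules (1)–(3); BCR1998 §2.2; Euler 1768; this node]
-/
noncomputable section

open Set MeasureTheory MvPolynomial Literature.NumberTheory.Transcendental
open Literature.ModelTheory.ExponentialFields (IsSemialgebraic isSemialgebraic_univ isSemialgebraic_setOf_eval_pos
  isSemialgebraic_setOf_eval_eq_zero isSemialgebraic_setOf_eval_lt)

namespace Summit.KontsevichZagierPeriods.RootDecompWalshStrata.ConicDescent.BallCube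

variable {κ₀ κ₁ : ℚ}

/-- `(x, t)₀ = x₀` on `Fin 2` (rfl helper; the twins in other parts are private). [folklore] -/
@[simp] private theorem snoc2_zero' (x : Fin 1 → ℝ) (t : ℝ) : (Fin.snoc x t : Fin 2 → ℝ) 0 = x 0 := rfl

/-- `(x, t)₁ = t` on `Fin 2` (rfl helper). [folklore] -/
@[simp] private theorem snoc2_one' (x : Fin 1 → ℝ) (t : ℝ) : (Fin.snoc x t : Fin 2 → ℝ) 1 = t := rfl

/-! #### 34.1 The hull margin -/

/-- **HULL MARGIN.** If `k₁ + k₂t ≥ m > 0` for some `t ≥ 0`, there are rationals `lo, hi` such that every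
`t ∈ [0, 1]` with `k₁ + k₂t ≥ m` lies in `[lo, hi]` and `k₁ + k₂t ≠ 0` on `[lo, hi]` (the pole `−k₁/k₂` stays
at distance `≥ m/|k₂|`; this is the hull hypothesis of the Euler terminal `InBaker.sqrt_rational`). [this node] -/
theorem exists_hull_of_margin (k₁ k₂ m : ℚ) (hm : 0 < m)
    (h0 : ∃ t : ℝ, 0 ≤ t ∧ (m : ℝ) ≤ k₁ + k₂ * t) :
    ∃ lo hi : ℚ, (∀ t : ℝ, 0 ≤ t → t ≤ 1 → (m : ℝ) ≤ k₁ + k₂ * t → (lo : ℝ) ≤ t ∧ t ≤ hi) ∧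
      ∀ t : ℝ, (lo : ℝ) ≤ t → t ≤ hi → (k₁ : ℝ) + k₂ * t ≠ 0 := by
  have hm' : (0 : ℝ) < m := by exact_mod_cast hm
  rcases lt_trichotomy k₂ 0 with hk | hk | hk
  · -- `k₂ < 0`: the admissible `t` form the half-line `t ≤ τ`, `τ = (m − k₁)/k₂`
    have hk' : (k₂ : ℝ) < 0 := by exact_mod_cast hk
    have hk0 : (k₂ : ℝ) ≠ 0 := hk'.ne
    have hτ : (k₂ : ℝ) * (((m - k₁) / k₂ : ℚ) : ℝ) = m - k₁ := by
      push_cast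
      field_simp
    refine ⟨min ((m - k₁) / k₂) 0, (m - k₁) / k₂, fun t ht0 _ hmt => ⟨?_, ?_⟩, fun t _ hhi hL => ?_⟩
    · push_cast
      exact (min_le_right _ _).trans ht0
    · by_contra hlt
      push Not at hlt
      have h1 := mul_lt_mul_of_neg_left hlt hk'
      rw [hτ] at h1
      linarith
    · have h1 := mul_le_mul_of_nonpos_left hhi hk'.le
      rw [hτ] at h1
      have h2 : (k₁ : ℝ) + k₂ * t = 0 := hL
      linarith
  · -- `k₂ = 0`: `k₁ ≥ m > 0`
    subst hk
    obtain ⟨t, -, ht⟩ := h0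
    push_cast at ht
    simp only [zero_mul, add_zero] at ht
    refine ⟨0, 1, fun t ht0 ht1 _ => ⟨by exact_mod_cast ht0, by exact_mod_cast ht1⟩,
      fun t _ _ hL => ?_⟩
    push_cast at hL
    simp only [zero_mul, add_zero] at hL
    linarith
  · -- `k₂ > 0`: the half-line `t ≥ τ`
    have hk' : (0 : ℝ) < k₂ := by exact_mod_cast hk
    have hk0 : (k₂ : ℝ) ≠ 0 := hk'.ne'
    have hτ : (k₂ : ℝ) * (((m - k₁) / k₂ : ℚ) : ℝ) = m - k₁ := by
      push_cast
      field_simp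
    refine ⟨(m - k₁) / k₂, max ((m - k₁) / k₂) 1, fun t _ ht1 hmt => ⟨?_, ?_⟩, fun t hlo _ hL => ?_⟩
    · by_contra hlt
      push Not at hlt
      have h1 := mul_lt_mul_of_pos_left hlt hk'
      rw [hτ] at h1
      linarith
    · push_cast
      exact ht1.trans (le_max_right _ _)
    · have h1 := mul_le_mul_of_nonneg_left hlo hk'.le
      rw [hτ] at h1
      have h2 : (k₁ : ℝ) + k₂ * t = 0 := hL
      linarith

/-! #### 34.2 The tangential stratum of the Euler terminal with a rational factor -/

/-- **TANGENTIAL RADICAND** (the `4eg = f²`, `e ≠ 0` stratum of `InBaker.sqrt_rational`), from the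
scaled rational class OF THE DENOMINATOR `Q` on the hull (`hSQ`: `[T', N'/Q·√m] ∈ InBaker` for every
`0 < m ∈ ℚ`, `N' ∈ ℚ[X]`, `T' ⊆ [0, 1]` in the hull — for `Q = s·L³·W` this is `InBaker.sqrt_const_LW`):
`√(ex² + fx + g) = √e·|x − x₁|`, `x₁ = −f/(2e)` (zero if `e < 0`); split at `x₁`. [this node] -/
theorem InBaker.sqrt_tangent (e f g : ℚ) (he : e ≠ 0) (hh : g - f ^ 2 / (4 * e) = 0)
    (N Q : Polynomial ℚ) (lo hi : ℚ)
    (hSQ : ∀ (m : ℚ), 0 < m → ∀ (N' : Polynomial ℚ) (r' : KZ.IntegralRep 1),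
      (∀ v ∈ r'.domain, (lo : ℝ) ≤ v 0 ∧ v 0 ≤ hi) → (∀ v ∈ r'.domain, 0 ≤ v 0 ∧ v 0 ≤ 1) →
      EqOn r'.integrand (fun v => Polynomial.aeval (v 0) N' / Polynomial.aeval (v 0) Q *
        √(qD 0 0 m (v 0))) r'.domain → InBaker (KZ.of r'))
    (r : KZ.IntegralRep 1) (hdom : ∀ v ∈ r.domain, (lo : ℝ) ≤ v 0 ∧ v 0 ≤ hi)
    (hI : ∀ v ∈ r.domain, 0 ≤ v 0 ∧ v 0 ≤ 1)
    (hr : EqOn r.integrand (fun v => Polynomial.aeval (v 0) N / Polynomial.aeval (v 0) Q *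
      √(qD e f g (v 0))) r.domain) :
    InBaker (KZ.of r) := by
  have he' : (e : ℝ) ≠ 0 := by exact_mod_cast he
  have hg : (g : ℝ) = f ^ 2 / (4 * e) := by
    have h : (((g - f ^ 2 / (4 * e) : ℚ)) : ℝ) = 0 := by exact_mod_cast hh
    push_cast at h
    linarith
  have hM : ∀ t : ℝ, qD e f g t = e * (t - (((-f / (2 * e) : ℚ)) : ℝ)) ^ 2 := fun t => by
    rw [qD, hg]
    push_cast
    field_simp
    ring
  rcases lt_or_gt_of_ne he with hneg | hpos
  · refine InBaker.of_mem_relations (KZ.of_mem_relations_of_eqOn_zero _ fun v hv => ?_)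
    rw [hr hv]
    have he2 : (e : ℝ) < 0 := by exact_mod_cast hneg
    have h0 : qD e f g (v 0) ≤ 0 := by
      rw [hM]
      nlinarith [sq_nonneg (v 0 - (((-f / (2 * e) : ℚ)) : ℝ))]
    simp [Real.sqrt_eq_zero'.2 h0]
  · have he2 : (0 : ℝ) < e := by exact_mod_cast hpos
    have hsqrt : ∀ t : ℝ, √(qD e f g t) = √(qD 0 0 e t) * |t - (((-f / (2 * e) : ℚ)) : ℝ)| :=
      fun t => by
        have h1 : qD 0 0 e t = e := by simp [qD]
        rw [hM, Real.sqrt_mul he2.le, Real.sqrt_sq_eq_abs, h1]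
    refine InBaker.of_split_at (-f / (2 * e)) r (fun r₁ hd₁ hi₁ => ?_) fun r₁ hd₁ hi₁ => ?_
    · refine hSQ e hpos (N * (Polynomial.X - Polynomial.C (-f / (2 * e)))) r₁
        (fun v hv => hdom v (by rw [hd₁] at hv; exact hv.1))
        (fun v hv => hI v (by rw [hd₁] at hv; exact hv.1)) fun v hv => ?_
      rw [hd₁] at hv
      rw [hi₁, hr hv.1]
      beta_reduce
      rw [hsqrt, abs_of_pos (sub_pos.2 hv.2)]
      simp only [map_mul, map_sub, Polynomial.aeval_X, Polynomial.aeval_C, eq_ratCast]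
      ring
    · refine hSQ e hpos (N * (Polynomial.C (-f / (2 * e)) - Polynomial.X)) r₁
        (fun v hv => hdom v (by rw [hd₁] at hv; exact hv.1))
        (fun v hv => hI v (by rw [hd₁] at hv; exact hv.1)) fun v hv => ?_
      rw [hd₁] at hv
      rw [hi₁, hr hv.1]
      beta_reduce
      rw [hsqrt, abs_of_neg (sub_neg.2 hv.2)]
      simp only [map_mul, map_sub, Polynomial.aeval_X, Polynomial.aeval_C, eq_ratCast]
      ring

/-! #### 34.3 The terminal on a line wall `k₀ + k₁X + k₂Y = 0`, `k₀ ≠ 0` -/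

/-- **SECTION TERM ON A LINE WALL.**  Along a rational line `k₀ + k₁X + k₂Y = 0` not through the centre,
the chart reads `r(k₁ + k₂t) = −k₀N(t)`; a section `r = ζ(t) > 0` on it over `t ∈ [0, 1]` with `r ≤ 1`
carries the primitive `P(t, ζ t) = (γ/(3a))·M(t)√M(t)/(|L|L²W)` with `L = k₁ + k₂t` (sign `−sgn k₀`,
`|L| ≥ min(1, k₀²κ₀)` on the section set), `W = κ₀ + κ₁t²`, `M = a k₀²W + cL² = et² + ft + g`, on the hull
of `exists_hull_of_margin`.  ALL strata: `e ≠ 0 ≠ 4eg − f²` — `InBaker.sqrt_rational` (landed);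
`e = 0 ≠ f` — `InBaker.linear_factor` (landed); `4eg = f²`, `e ≠ 0` — `InBaker.sqrt_tangent`; `e = f = 0`
— the constant radicand `g` (zero if `g ≤ 0`), the last two through the scaled rational class of the
denominator `|L|L²W`, `InBaker.sqrt_const_LW` (§35). [KontsevichZagier2001 §1.2; Euler 1768; this node] -/
theorem InBaker.psection_line (hκ : 0 < κ₀ ∧ 0 ≤ κ₁) (γ a c : ℚ) (ha : a ≠ 0) (k₀ k₁ k₂ : ℚ)
    (hk₀ : k₀ ≠ 0) {S : Set (Fin 1 → ℝ)} (ζ : (Fin 1 → ℝ) → ℝ) (hS01 : ∀ x ∈ S, 0 ≤ x 0 ∧ x 0 ≤ 1)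
    (hζ : ∀ x ∈ S, 0 < ζ x ∧ ζ x ^ 2 ≤ 1)
    (hwall : ∀ x ∈ S, ζ x * (k₁ + k₂ * x 0) = -k₀ * pN κ₀ κ₁ (x 0))
    (r₁ : KZ.IntegralRep 1) (hr₁ : r₁.domain ⊆ S)
    (hint : EqOn r₁.integrand (fun x => ppot κ₀ κ₁ γ a c (Fin.snoc x (ζ x))) r₁.domain) :
    InBaker (KZ.of r₁) := by
  rcases r₁.domain.eq_empty_or_nonempty with h0 | ⟨x₀, hx₀⟩
  · exact InBaker.of_domain_eq_empty r₁ h0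
  have hκ0 : (0 : ℝ) < κ₀ := by exact_mod_cast hκ.1
  have hκ1 : (0 : ℝ) ≤ κ₁ := by exact_mod_cast hκ.2
  have hk₀' : (k₀ : ℝ) ≠ 0 := by exact_mod_cast hk₀
  have ha' : (a : ℝ) ≠ 0 := by exact_mod_cast ha
  -- `L = k₁ + k₂t` has the sign of `−k₀` on `S`
  have hLk : ∀ x ∈ S, 0 < -(k₀ : ℝ) * (k₁ + k₂ * x 0) := fun x hx => by
    obtain ⟨hz, -⟩ := hζ x hx
    have hN := pN_pos hκ (x 0)
    have hw := hwall x hx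
    have hL : (k₁ : ℝ) + k₂ * x 0 = -k₀ * pN κ₀ κ₁ (x 0) / ζ x := by
      rw [eq_div_iff hz.ne', mul_comm]
      exact hw
    rw [hL, show -(k₀ : ℝ) * (-k₀ * pN κ₀ κ₁ (x 0) / ζ x) = k₀ ^ 2 * pN κ₀ κ₁ (x 0) / ζ x by ring]
    positivity
  obtain ⟨s₀, hs₀, hsL⟩ : ∃ s₀ : ℚ, (s₀ = 1 ∨ s₀ = -1) ∧
      ∀ x ∈ S, 0 < (s₀ : ℝ) * (k₁ + k₂ * x 0) := by
    rcases lt_or_gt_of_ne hk₀ with hneg | hpos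
    · refine ⟨1, Or.inl rfl, fun x hx => ?_⟩
      have h := hLk x hx
      have h' : (0 : ℝ) < -k₀ := by exact_mod_cast neg_pos.2 hneg
      push_cast
      rw [one_mul]
      exact pos_of_mul_pos_right h h'.le
    · refine ⟨-1, Or.inr rfl, fun x hx => ?_⟩
      have h := hLk x hx
      have h' : (0 : ℝ) < k₀ := by exact_mod_cast hpos
      rw [show -(k₀ : ℝ) * (k₁ + k₂ * x 0) = k₀ * (-1 * (k₁ + k₂ * x 0)) by ring] at h
      push_cast
      exact pos_of_mul_pos_right h h'.le
  have hs₀0 : (s₀ : ℝ) ≠ 0 := by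
    rcases hs₀ with rfl | rfl <;> norm_num
  -- the margin `m ≤ |L| = s₀L` on `S`
  obtain ⟨m, hm, hm1, hmμ⟩ : ∃ m : ℚ, 0 < m ∧ m ≤ 1 ∧ m ≤ k₀ ^ 2 * κ₀ :=
    ⟨min 1 (k₀ ^ 2 * κ₀), lt_min one_pos (mul_pos (by positivity) hκ.1), min_le_left _ _,
      min_le_right _ _⟩
  have hmarg : ∀ x ∈ S, (m : ℝ) ≤ ((s₀ * k₁ : ℚ) : ℝ) + ((s₀ * k₂ : ℚ) : ℝ) * x 0 := fun x hx => by
    obtain ⟨hz, hz1⟩ := hζ x hx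
    have hw := hwall x hx
    have hW := pN_sq hκ (x 0)
    have hsl := hsL x hx
    have hsq : ζ x ^ 2 * (k₁ + k₂ * x 0) ^ 2 = k₀ ^ 2 * (κ₀ + κ₁ * x 0 ^ 2) := by
      rw [← hW, ← mul_pow, hw]
      ring
    have hL2 : (m : ℝ) ^ 2 ≤ (k₁ + k₂ * x 0) ^ 2 := by
      have h1 : (m : ℝ) ≤ 1 := by exact_mod_cast hm1
      have h2 : (m : ℝ) ≤ k₀ ^ 2 * κ₀ := by exact_mod_cast hmμ
      have hm' : (0 : ℝ) < m := by exact_mod_cast hm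
      nlinarith [sq_nonneg ((k₁ : ℝ) + k₂ * x 0), mul_nonneg hκ1 (sq_nonneg (x 0)),
        mul_le_mul_of_nonneg_left hz1 (sq_nonneg ((k₁ : ℝ) + k₂ * x 0)), sq_nonneg (k₀ : ℝ),
        mul_nonneg (sq_nonneg (k₀ : ℝ)) (mul_nonneg hκ1 (sq_nonneg (x 0)))]
    have habs : (m : ℝ) ≤ |(k₁ : ℝ) + k₂ * x 0| := by
      have h := Real.sqrt_le_sqrt hL2
      rwa [Real.sqrt_sq (by exact_mod_cast hm.le), Real.sqrt_sq_eq_abs] at h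
    have key : (m : ℝ) ≤ s₀ * (k₁ + k₂ * x 0) := by
      rcases hs₀ with rfl | rfl
      · push_cast at hsl ⊢
        rw [one_mul] at hsl ⊢
        rwa [abs_of_pos hsl] at habs
      · push_cast at hsl ⊢
        have hneg : (k₁ : ℝ) + k₂ * x 0 < 0 := by linarith
        rw [abs_of_neg hneg] at habs
        linarith
    have hring : (s₀ : ℝ) * (k₁ + k₂ * x 0) = s₀ * k₁ + s₀ * k₂ * x 0 := by ring
    push_cast
    linarith
  -- the hull for the Euler terminal
  obtain ⟨lo, hi, hhull, hQ0⟩ := exists_hull_of_margin (s₀ * k₁) (s₀ * k₂) m hm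
    ⟨x₀ 0, (hS01 x₀ (hr₁ hx₀)).1, hmarg x₀ (hr₁ hx₀)⟩
  -- `L ≠ 0` on the hull
  have hL1 : ∀ t : ℝ, (lo : ℝ) ≤ t → t ≤ hi → (k₁ : ℝ) + k₂ * t ≠ 0 := fun t hlo hhi h => by
    apply hQ0 t hlo hhi
    have : ((s₀ * k₁ : ℚ) : ℝ) + ((s₀ * k₂ : ℚ) : ℝ) * t = s₀ * (k₁ + k₂ * t) := by
      push_cast
      ring
    rw [this, h, mul_zero]
  -- the data `N₁/Q₁·√M` common to all strata: `N₁ = (γ/(3a))M`, `Q₁ = (s₀L)·L²·W = |L|L²W`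
  have hQ1 : ∀ t : ℝ, (lo : ℝ) ≤ t → t ≤ hi → Polynomial.aeval t
      ((Polynomial.C (s₀ * k₁) + Polynomial.C (s₀ * k₂) * Polynomial.X) *
        (Polynomial.C k₁ + Polynomial.C k₂ * Polynomial.X) ^ 2 *
        (Polynomial.C κ₀ + Polynomial.C κ₁ * Polynomial.X ^ 2)) ≠ 0 := fun t hlo hhi => by
    have h1 := hQ0 t hlo hhi
    have h2 : (k₁ : ℝ) + k₂ * t ≠ 0 := hL1 t hlo hhi
    have h3 : (0 : ℝ) < κ₀ + κ₁ * t ^ 2 := by nlinarith [mul_nonneg hκ1 (sq_nonneg t)]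
    have h1' : (s₀ : ℝ) * k₁ + s₀ * k₂ * t ≠ 0 := by
      push_cast at h1
      exact h1
    simp only [map_mul, map_add, map_pow, Polynomial.aeval_C, Polynomial.aeval_X, eq_ratCast]
    exact mul_ne_zero (mul_ne_zero h1' (pow_ne_zero 2 h2)) h3.ne'
  have hdom1 : ∀ v ∈ r₁.domain, (lo : ℝ) ≤ v 0 ∧ v 0 ≤ hi := fun v hv => by
    have hvS : v ∈ S := hr₁ hv
    exact hhull (v 0) (hS01 v hvS).1 (hS01 v hvS).2 (hmarg v hvS)
  have hr1 : EqOn r₁.integrand (fun v => Polynomial.aeval (v 0)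
      (Polynomial.C (γ / (3 * a)) * (Polynomial.C (a * k₀ ^ 2 * κ₁ + c * k₂ ^ 2) *
        Polynomial.X ^ 2 + Polynomial.C (2 * c * k₁ * k₂) * Polynomial.X +
        Polynomial.C (a * k₀ ^ 2 * κ₀ + c * k₁ ^ 2))) /
      Polynomial.aeval (v 0)
        ((Polynomial.C (s₀ * k₁) + Polynomial.C (s₀ * k₂) * Polynomial.X) *
          (Polynomial.C k₁ + Polynomial.C k₂ * Polynomial.X) ^ 2 *
          (Polynomial.C κ₀ + Polynomial.C κ₁ * Polynomial.X ^ 2)) *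
      √(qD (a * k₀ ^ 2 * κ₁ + c * k₂ ^ 2) (2 * c * k₁ * k₂) (a * k₀ ^ 2 * κ₀ + c * k₁ ^ 2)
        (v 0))) r₁.domain := fun v hv => by
    have hvS : v ∈ S := hr₁ hv
    obtain ⟨hz, -⟩ := hζ v hvS
    have hw := hwall v hvS
    have hW := pN_sq hκ (v 0)
    have hsl := hsL v hvS
    have hL0 : (k₁ : ℝ) + k₂ * v 0 ≠ 0 := fun h => by
      rw [h, mul_zero] at hsl
      exact lt_irrefl _ hsl
    have hWp : (0 : ℝ) < κ₀ + κ₁ * v 0 ^ 2 := by nlinarith [mul_nonneg hκ1 (sq_nonneg (v 0))]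
    have hz2 : ζ v ^ 2 = k₀ ^ 2 * (κ₀ + κ₁ * v 0 ^ 2) / (k₁ + k₂ * v 0) ^ 2 := by
      rw [eq_div_iff (pow_ne_zero 2 hL0), ← hW, ← mul_pow, hw]
      ring
    have hM : (a : ℝ) * ζ v ^ 2 + c =
        qD (a * k₀ ^ 2 * κ₁ + c * k₂ ^ 2) (2 * c * k₁ * k₂) (a * k₀ ^ 2 * κ₀ + c * k₁ ^ 2) (v 0) /
          (k₁ + k₂ * v 0) ^ 2 := by
      rw [hz2, qD, eq_div_iff (pow_ne_zero 2 hL0), add_mul, mul_assoc,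
        div_mul_cancel₀ _ (pow_ne_zero 2 hL0)]
      push_cast
      ring
    have habs : |(k₁ : ℝ) + k₂ * v 0| = s₀ * (k₁ + k₂ * v 0) := by
      rcases hs₀ with rfl | rfl
      · push_cast at hsl ⊢
        rw [one_mul] at hsl ⊢
        exact abs_of_pos hsl
      · push_cast at hsl ⊢
        have hneg : (k₁ : ℝ) + k₂ * v 0 < 0 := by linarith
        rw [abs_of_neg hneg]
        ring
    show r₁.integrand v = _
    rw [hint hv]
    beta_reduce
    rw [ppot, snoc2_zero', snoc2_one', ph, hM, Real.sqrt_div' _ (sq_nonneg _), Real.sqrt_sq_eq_abs,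
      habs]
    have hWne : (κ₀ : ℝ) + κ₁ * v 0 ^ 2 ≠ 0 := hWp.ne'
    simp only [map_mul, map_add, map_pow, Polynomial.aeval_C, Polynomial.aeval_X, eq_ratCast, qD]
    push_cast
    field_simp
  -- the scaled rational class of `Q₁ = s₀·L³·W` (§35)
  have hI1 : ∀ v ∈ r₁.domain, 0 ≤ v 0 ∧ v 0 ≤ 1 := fun v hv => hS01 v (hr₁ hv)
  have hs₀' : s₀ ≠ 0 := by
    rcases hs₀ with rfl | rfl <;> norm_num
  have hSQ : ∀ (m' : ℚ), 0 < m' → ∀ (N' : Polynomial ℚ) (r' : KZ.IntegralRep 1),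
      (∀ v ∈ r'.domain, (lo : ℝ) ≤ v 0 ∧ v 0 ≤ hi) → (∀ v ∈ r'.domain, 0 ≤ v 0 ∧ v 0 ≤ 1) →
      EqOn r'.integrand (fun v => Polynomial.aeval (v 0) N' / Polynomial.aeval (v 0)
        ((Polynomial.C (s₀ * k₁) + Polynomial.C (s₀ * k₂) * Polynomial.X) *
          (Polynomial.C k₁ + Polynomial.C k₂ * Polynomial.X) ^ 2 *
          (Polynomial.C κ₀ + Polynomial.C κ₁ * Polynomial.X ^ 2)) * √(qD 0 0 m' (v 0))) r'.domain →
      InBaker (KZ.of r') := fun m' hm' N' r' hd' hI' hr' =>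
    InBaker.sqrt_const_LW m' hm' hκ s₀ k₁ k₂ hs₀' N' lo hi hL1 r' hd' hI' hr'
  -- dispatch on the stratum of the radicand `M = e t² + f t + g`
  by_cases he : a * k₀ ^ 2 * κ₁ + c * k₂ ^ 2 = 0
  · by_cases hf : 2 * c * k₁ * k₂ = 0
    · -- constant radicand `g`
      by_cases hg : 0 < a * k₀ ^ 2 * κ₀ + c * k₁ ^ 2
      · exact hSQ _ hg _ r₁ hdom1 hI1 fun v hv => by rw [hr1 hv, he, hf]
      · refine InBaker.of_mem_relations (KZ.of_mem_relations_of_eqOn_zero _ fun v hv => ?_)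
        rw [hr1 hv, he, hf]
        have h0 : qD 0 0 (a * k₀ ^ 2 * κ₀ + c * k₁ ^ 2) (v 0) ≤ 0 := by
          simp only [qD, Rat.cast_zero, zero_mul, zero_add]
          exact_mod_cast not_lt.1 hg
        simp [Real.sqrt_eq_zero'.2 h0]
    · exact InBaker.linear_factor _ _ hf _ _ r₁ (fun v hv => hQ1 _ (hdom1 v hv).1 (hdom1 v hv).2)
        fun v hv => by rw [hr1 hv, he]
  · by_cases hh : a * k₀ ^ 2 * κ₀ + c * k₁ ^ 2 -
      (2 * c * k₁ * k₂) ^ 2 / (4 * (a * k₀ ^ 2 * κ₁ + c * k₂ ^ 2)) = 0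
    · exact InBaker.sqrt_tangent _ _ _ he hh _ _ lo hi hSQ r₁ hdom1 hI1 hr1
    · exact InBaker.sqrt_rational _ _ _ he hh _ _ lo hi hQ1 r₁ hdom1 hr1

end Summit.KontsevichZagierPeriods.RootDecompWalshStrata.ConicDescent.BallCube

end
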